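import Mathlib
import Summits.Ventures.PercRepro2.Defs
import Summits.Ventures.PercRepro2.Harris
import Summits.Ventures.PercRepro2.Graph
import Summits.Ventures.PercRepro2.Induced
import Summits.Ventures.PercRepro2.VdBKahn
import Summits.Ventures.PercRepro2.BHK
import Summits.Ventures.PercRepro2.BHKEvents
import Summits.Ventures.PercRepro2.WForm
import Summits.Ventures.PercRepro2.WStatus
import Summits.Ventures.PercRepro2.WAltDefs

/-!
# The status dictionary: conditional status sums are avoidance expectations, and BHK gives (H1)
(blind cell PercRepro2, mine-1 g15; proofs/MINE1-W-THEOREM.md §2, §4 (v))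

For the status law `W = statusW p ends s T F` and the relation `D = Disjoint` on `Finset V`:
* `status ends s F ω = C(s) ∩ F` (classical decidability), and for `S ⊆ F` the status event
  `connAll s S ∩ avoidAll s (T ∪ (F \ S))` is `{status = S} ∩ avoidAll s T`
  (`mem_statusEvent_iff_status`);
* **dictionary** `∑_S cw S t g S = E[g(status) · 1{C ∩ (T ∪ (t ∩ F)) = ∅}]` (`sum_cw_statusW_eq`)
  and `Z t = P(C ∩ (T ∪ (t ∩ F)) = ∅)` (`Z_statusW_eq`);
* hence **(H1)** for the status law is van den Berg–Häggström–Kahn's conditional positive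
  association with the avoided set `T ∪ (t ∩ F)` (`bhk_induced` with `X = Y`, applied to the
  monotone nonnegative cluster functionals `C ↦ g(C ∩ F) − min g`): `condPA_statusW`.
-/

namespace Summit.Ventures.PercRepro2

section Dictionary

variable {V : Type*} {E : Type*} [Fintype E] [DecidableEq E] [Fintype V] [DecidableEq V]
  {R : Type*} [Field R] [LinearOrder R] [IsStrictOrderedRing R]
variable (p : E → R) (ends : E → Sym2 V) (s : V) (T F : Finset V)

/-- The status `C(s) ∩ F` of a configuration, as a finset (classical decidability). -/
noncomputable def status (ω : Config E) : Finset V :=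
  @Finset.filter V (fun v => v ∈ cluster ends ω s) (Classical.decPred _) F

omit [Fintype E] [DecidableEq E] [Fintype V] [DecidableEq V] in
/-- Membership in the status. -/
lemma mem_status {ω : Config E} {v : V} :
    v ∈ status ends s F ω ↔ v ∈ F ∧ Conn ends ω s v := by
  simp [status]

omit [Fintype E] [DecidableEq E] [Fintype V] [DecidableEq V] in
/-- The status is a subset of the test set. -/
lemma status_subset (ω : Config E) : status ends s F ω ⊆ F :=
  fun _ hv => ((mem_status ends s F).mp hv).1

omit [Fintype E] [DecidableEq E] [Fintype V] in
/-- The status event: for `S ⊆ F`, `ω ∈ connAll s S ∩ avoidAll s (T ∪ (F \ S))` iff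
`status ω = S` and `ω` avoids `T`. -/
lemma mem_statusEvent_iff_status {S : Finset V} (hS : S ⊆ F) (ω : Config E) :
    ω ∈ connAll ends s S ∩ avoidAll ends s (T ∪ (F \ S)) ↔
      status ends s F ω = S ∧ ω ∈ avoidAll ends s T := by
  constructor
  · rintro ⟨h1, h2⟩
    refine ⟨?_, fun x hx => h2 x (Finset.mem_union_left _ hx)⟩
    ext v
    rw [mem_status]
    constructor
    · rintro ⟨hvF, hv⟩
      by_contra hvS
      exact h2 v (Finset.mem_union_right _ (Finset.mem_sdiff.mpr ⟨hvF, hvS⟩)) hv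
    · intro hvS
      exact ⟨hS hvS, h1 v hvS⟩
  · rintro ⟨h1, h2⟩
    refine ⟨fun a ha => ?_, fun x hx => ?_⟩
    · rw [← h1, mem_status] at ha; exact ha.2
    · rcases Finset.mem_union.mp hx with hx | hx
      · exact h2 x hx
      · rw [Finset.mem_sdiff, ← h1, mem_status] at hx
        exact fun hc => hx.2 ⟨hx.1, hc⟩

omit [Fintype E] [DecidableEq E] [Fintype V] in
/-- The status is disjoint from `t` iff the cluster avoids `t ∩ F`. -/
lemma disjoint_status_iff (ω : Config E) (t : Finset V) :
    Disjoint (status ends s F ω) t ↔ ∀ x ∈ t ∩ F, ¬ Conn ends ω s x := by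
  rw [Finset.disjoint_left]
  constructor
  · intro h x hx hc
    rw [Finset.mem_inter] at hx
    exact h ((mem_status ends s F).mpr ⟨hx.2, hc⟩) hx.1
  · intro h v hv hvt
    rw [mem_status] at hv
    exact h v (Finset.mem_inter.mpr ⟨hvt, hv.1⟩) hv.2

omit [Fintype E] [DecidableEq E] [Fintype V] in
/-- The avoidance of `T ∪ (t ∩ F)` is «avoid `T` and the status is disjoint from `t`». -/
lemma mem_avoidAll_union_iff (ω : Config E) (t : Finset V) :
    ω ∈ avoidAll ends s (T ∪ (t ∩ F)) ↔
      Disjoint (status ends s F ω) t ∧ ω ∈ avoidAll ends s T := by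
  rw [disjoint_status_iff]
  constructor
  · intro hA
    exact ⟨fun x hx => hA x (Finset.mem_union_right _ hx),
      fun x hx => hA x (Finset.mem_union_left _ hx)⟩
  · rintro ⟨h1, h2⟩ x hx
    rcases Finset.mem_union.mp hx with hx | hx
    · exact h2 x hx
    · exact h1 x hx

omit [LinearOrder R] [IsStrictOrderedRing R] in
/-- **Dictionary**: the conditional status sum `∑_S cw S t g S` is the expectation of
`g(C ∩ F) · 1{C ∩ (T ∪ (t ∩ F)) = ∅}`. -/
lemma sum_cw_statusW_eq (g : Finset V → R) (t : Finset V) :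
    ∑ S, WForm.cw (fun S S' : Finset V => Disjoint S S') (statusW p ends s T F) S t * g S =
      expect p (fun ω => g (status ends s F ω) *
        (avoidAll ends s (T ∪ (t ∩ F))).indicator 1 ω) := by
  have e1 : ∀ S, WForm.cw (fun S S' : Finset V => Disjoint S S') (statusW p ends s T F) S t * g S =
      ∑ ω, weight p ω * ((if Disjoint S t ∧ S ⊆ F then (1 : R) else 0) *
        (connAll ends s S ∩ avoidAll ends s (T ∪ (F \ S))).indicator 1 ω * g S) := by
    intro S
    unfold WForm.cw statusW statusMass
    by_cases hD : Disjoint S t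
    · by_cases hS : S ⊆ F
      · rw [if_pos hD, if_pos hS, if_pos ⟨hD, hS⟩, prob_eq_expect_indicator]
        unfold expect
        rw [Finset.sum_mul]
        refine Finset.sum_congr rfl fun ω _ => ?_
        ring
      · rw [if_pos hD, if_neg hS, if_neg (fun h => hS h.2)]
        simp
    · rw [if_neg hD, if_neg (fun h => hD h.1)]
      simp
  simp_rw [e1]
  rw [Finset.sum_comm]
  unfold expect
  refine Finset.sum_congr rfl fun ω _ => ?_
  dsimp only
  rw [← Finset.mul_sum]
  congr 1
  rw [Finset.sum_eq_single (status ends s F ω)]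
  · by_cases hA : ω ∈ avoidAll ends s (T ∪ (t ∩ F))
    · have hA' := (mem_avoidAll_union_iff ends s T F ω t).mp hA
      rw [Set.indicator_of_mem hA, if_pos ⟨hA'.1, status_subset ends s F ω⟩,
        Set.indicator_of_mem ((mem_statusEvent_iff_status ends s T F (status_subset ends s F ω) ω).mpr
          ⟨rfl, hA'.2⟩)]
      simp
    · rw [Set.indicator_of_notMem hA]
      by_cases hD : Disjoint (status ends s F ω) t
      · have hT : ω ∉ avoidAll ends s T := fun hT =>
          hA ((mem_avoidAll_union_iff ends s T F ω t).mpr ⟨hD, hT⟩)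
        have hE : ω ∉ connAll ends s (status ends s F ω) ∩
            avoidAll ends s (T ∪ (F \ status ends s F ω)) := fun hE =>
          hT ((mem_statusEvent_iff_status ends s T F (status_subset ends s F ω) ω).mp hE).2
        rw [Set.indicator_of_notMem hE]
        simp
      · rw [if_neg (fun h => hD h.1)]
        simp
  · intro S _ hne
    by_cases hS : S ⊆ F
    · have hE : ω ∉ connAll ends s S ∩ avoidAll ends s (T ∪ (F \ S)) := fun hE =>
        hne ((mem_statusEvent_iff_status ends s T F hS ω).mp hE).1.symm
      rw [Set.indicator_of_notMem hE]
      simp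
    · rw [if_neg (fun h => hS h.2)]
      simp
  · intro h; exact absurd (Finset.mem_univ _) h

omit [LinearOrder R] [IsStrictOrderedRing R] in
/-- The normaliser is the avoidance probability. -/
lemma Z_statusW_eq (t : Finset V) :
    WForm.Z (fun S S' : Finset V => Disjoint S S') (statusW p ends s T F) t =
      prob p (avoidAll ends s (T ∪ (t ∩ F))) := by
  unfold WForm.Z
  have := sum_cw_statusW_eq p ends s T F (fun _ => (1 : R)) t
  simp only [mul_one, one_mul] at this
  rw [this, prob_eq_expect_indicator]

omit [LinearOrder R] [IsStrictOrderedRing R] in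
/-- Linearity of `expect` on a shifted product. -/
lemma expect_sub_const_mul_indicator (f : Config E → R) (c : R) (A : Set (Config E)) :
    expect p (fun ω => (f ω - c) * A.indicator 1 ω) =
      expect p (fun ω => f ω * A.indicator 1 ω) - c * prob p A := by
  rw [prob_eq_expect_indicator]
  unfold expect
  rw [Finset.mul_sum, ← Finset.sum_sub_distrib]
  refine Finset.sum_congr rfl fun ω _ => ?_
  ring

omit [LinearOrder R] [IsStrictOrderedRing R] in
/-- Linearity of `expect` on a product of two shifted functions. -/
lemma expect_sub_mul_sub_mul_indicator (f g : Config E → R) (c d : R) (A : Set (Config E)) :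
    expect p (fun ω => (f ω - c) * (g ω - d) * A.indicator 1 ω) =
      expect p (fun ω => f ω * g ω * A.indicator 1 ω) - d * expect p (fun ω => f ω * A.indicator 1 ω)
        - c * expect p (fun ω => g ω * A.indicator 1 ω) + c * d * prob p A := by
  rw [prob_eq_expect_indicator]
  unfold expect
  rw [Finset.mul_sum, Finset.mul_sum, Finset.mul_sum, ← Finset.sum_sub_distrib,
    ← Finset.sum_sub_distrib, ← Finset.sum_add_distrib]
  refine Finset.sum_congr rfl fun ω _ => ?_
  ring

/-- The cluster functional `C ↦ g (C ∩ F) − c` (classical decidability of `· ∈ C`). -/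
noncomputable def clusterStatusFun (g : Finset V → R) (c : R) : Set V → R :=
  fun C => g (@Finset.filter V (fun v => v ∈ C) (Classical.decPred _) F) - c

omit [Fintype E] [DecidableEq E] [Fintype V] [DecidableEq V] [LinearOrder R] [IsStrictOrderedRing R] in
/-- The cluster functional evaluated on the cluster is the shifted status function. -/
lemma clusterStatusFun_cluster (g : Finset V → R) (c : R) (ω : Config E) :
    clusterStatusFun F g c (cluster ends ω s) = g (status ends s F ω) - c := rfl

omit [Fintype E] [DecidableEq E] [Fintype V] [DecidableEq V] in
/-- The cluster functional is monotone for monotone `g`. -/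
lemma monotone_clusterStatusFun {g : Finset V → R} (hg : Monotone g) (c : R) :
    Monotone (clusterStatusFun F g c) := by
  intro C C' hCC'
  unfold clusterStatusFun
  have hsub : @Finset.filter V (fun v => v ∈ C) (Classical.decPred _) F ⊆
      @Finset.filter V (fun v => v ∈ C') (Classical.decPred _) F :=
    @Finset.monotone_filter_right V F _ _ (Classical.decPred _) (Classical.decPred _)
      (fun _ _ hv => hCC' hv)
  linarith [hg hsub]

omit [Fintype E] [DecidableEq E] [DecidableEq V] in
/-- Shifting by the minimum makes the cluster functional nonnegative. -/
lemma clusterStatusFun_nonneg (g : Finset V → R) (C : Set V) :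
    0 ≤ clusterStatusFun F g (WForm.lo (∅ : Finset V) g) C :=
  sub_nonneg.mpr (WForm.lo_le (∅ : Finset V) g _)

/-- **(H1) for the status law** — van den Berg–Häggström–Kahn (`bhk_induced` with `X = Y`): every
conditional status weight `cw (·, t)` is positively associated for monotone pairs. -/
theorem condPA_statusW (hp : IsProbVec p) :
    WForm.CondPA (fun S S' : Finset V => Disjoint S S') (statusW p ends s T F) := by
  intro t g h hg hh
  set X : Finset V := T ∪ (t ∩ F) with hX
  set A : Set (Config E) := avoidAll ends s X with hA
  set m₁ : R := WForm.lo (∅ : Finset V) g with hm₁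
  set m₂ : R := WForm.lo (∅ : Finset V) h with hm₂
  have hbhk := bhk_induced p hp ends s (monotone_clusterStatusFun F hg m₁)
    (monotone_clusterStatusFun F hh m₂) (clusterStatusFun_nonneg F g)
    (clusterStatusFun_nonneg F h) Finset.univ X X (Finset.subset_univ _) (Finset.subset_univ _)
  simp only [Finset.inter_self, Finset.union_self, REvent_univ] at hbhk
  have e : ∀ (G : Set V → R), clusterObs ends Finset.univ s G * A.indicator 1 =
      fun ω => G (cluster ends ω s) * A.indicator 1 ω := by
    intro G
    funext ω
    simp only [Pi.mul_apply, clusterObs_apply, clusterIn_univ]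
  rw [e, e, e] at hbhk
  simp only [Pi.mul_apply, clusterStatusFun_cluster] at hbhk
  rw [expect_sub_const_mul_indicator, expect_sub_const_mul_indicator,
    expect_sub_mul_sub_mul_indicator] at hbhk
  -- the dictionary
  have d1 := sum_cw_statusW_eq p ends s T F g t
  have d2 := sum_cw_statusW_eq p ends s T F h t
  have d3 := sum_cw_statusW_eq p ends s T F (fun S => g S * h S) t
  have dZ := Z_statusW_eq p ends s T F t
  rw [d1, d2, d3, dZ]
  rw [← hX, ← hA] at *
  nlinarith [hbhk]

end Dictionary

end Summit.Ventures.PercRepro2
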